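import Mathlib
import Literature.RingTheory.HopfAlgebra.FiniteDualBialgebraLaws
import Literature.AlgebraicGeometry.Motives.TannakianDistributionsDiagonal
import Literature.AlgebraicGeometry.Motives.TannakianDistributionsAntipode
import HarnessLib

/-!
# The dual Hopf algebra `B^*` of a finite free Hopf algebra, bundled: Mathlib `Coalgebra ∕ Bialgebra ∕ HopfAlgebra`
# structures on the convolution carrier `WithConv (Module.Dual R B)`
(Tate, *Finite flat group schemes* (in Cornell–Silverman–Stevens 1997), §(3.8) «The dual Hopf algebra and Cartier
duality», pp. 144–146; Montgomery, *Hopf algebras and their actions on rings*, CBMS 82 (1993), 9.1.3 («`H^*` is a Hopf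
algebra with `m_{H^*} = Δ^*`, `Δ_{H^*} = m^*`, `S_{H^*} = S^*`»))

Topic `RingTheory/HopfAlgebra`; namespace `Literature.RingTheory.HopfAlgebra.FiniteDual`.  DEFINITIONS with bodies +
THEOREMS; NO `instance` (the structures are reducible `def`s a consumer installs with `letI`), no notation, no named fact,
no `sorry`; Mathlib + ★ `FiniteDualCoalgebraLaws` ∕ `FiniteDualBialgebraLaws` (CD1-thm, where every law is proved in
hypothesis style) + the tree's ★ `Motives/TannakianDistributions{Diagonal,Antipode}` (lit-hodgefound g41) whose vocabulary
`Tannakian.dualDiag ∕ dualCounit ∕ dualAntipode ∕ tensorDual` this bundle RE-USES (the antipode IS `Tannakian.dualAntipode`)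
and BRIDGES (§3).  Cell `pub/hodgecm-mathlib` (D-0151), FLOOR 0, programme F0P5a (crux item stmt-HodgeConjecture-24832;
PLAN v4.1 §2 row H-CD «Cartier duality at `p`», KF8; piece **CD1 = the bundle**) — road- and floor-independent commutative
algebra; changes no count.

CONTENT (`R` a commutative semiring, `B` finite free over `R`; `W := WithConv (Module.Dual R B)`, whose ALGEBRA structure
is Mathlib's convolution algebra `LinearMap.convAlgebra` whenever `B` is a coalgebra):
* §1 the structure maps as definitions — **`evalTwo R B : W ⊗[R] W →ₗ[R] Dual R (B ⊗[R] B)`** (`= dualDistrib ∘ map ofConv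
  ofConv`, `evalTwo_tmul : evalTwo R B (g ⊗ h) (x ⊗ y) = g x * h y`; bijective: **`evalTwoEquiv`**), **`comul R B : W →ₗ[R]
  W ⊗[R] W`** (`μ^*` read through `evalTwoEquiv`; `evalTwo_comul : evalTwo R B (comul R B f) (x ⊗ y) = f (x * y)`),
  **`counit R B : W →ₗ[R] R`** (`counit_apply : counit R B f = f 1`); the antipode is the tree's ★ `Tannakian.dualAntipode`
  (`Tannakian.dualAntipode_apply_apply : dualAntipode f x = f (S x)`);
* §2 **`coalgebra R B : Coalgebra R W`** (`B` an `R`-algebra), **`bialgebra R B : Bialgebra R W`** (`B` a bialgebra; its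
  `toAlgebra` IS `LinearMap.convAlgebra`), **`hopfAlgebra R B : HopfAlgebra R W`** (`B` a Hopf algebra) — every field
  discharged by the CD1-thm theorem of the same name; **`isCocomm`** (`B` commutative ⇒ `W` cocommutative);
* §3 bridges: `comul_def ∕ counit_def ∕ antipode_def ∕ bialgebra_toAlgebra` (the class projections are §1's maps ∕ Mathlib's
  `LinearMap.convAlgebra`, all `rfl`) and, for commutative `B` over a commutative ring, the dictionary with the Tannakian files:
  **`evalTwo_tmul_eq_tensorDual`** (`evalTwo (g ⊗ h) = Tannakian.tensorDual g h`), **`evalTwo_comul_eq_dualDiag`**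
  (`evalTwo (comul f) = (Tannakian.dualDiag R B f).ofConv`), **`counit_eq_dualCounit`** (`counit R B = Tannakian.dualCounit R B`
  as linear maps).
NOT here: points (★ `FiniteDualPoints`), base change (`FiniteDualBaseChange`), the bidual `B ≃ B^**`, quotients, schemes.

HC_CM is proved only modulo the 7 printed citations until rung 0 closes; this file is generic algebra and changes no count.

## References
* [Tate1997FiniteFlatGroupSchemes] J. Tate, *Finite flat group schemes*, in: Modular Forms and Fermat's Last Theorem (1997), §(3.8)
  pp. 144–146.
* [Montgomery1993Hopf] S. Montgomery, *Hopf algebras and their actions on rings*, CBMS 82 (1993), 9.1.3.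
-/

set_option autoImplicit false

noncomputable section

open TensorProduct Module WithConv

namespace Literature.RingTheory.HopfAlgebra

namespace FiniteDual

universe u v

/-! ## §1 The structure maps -/

section Maps

variable (R : Type u) [CommSemiring R] (B : Type v) [AddCommMonoid B] [Module R B]

/-- **the evaluation pairing `B^* ⊗ B^* → (B ⊗ B)^*`**, `g ⊗ h ↦ (x ⊗ y ↦ g x * h y)` (Mathlib's `TensorProduct.dualDistrib`
read on the convolution carrier). [cite: Tate1997FiniteFlatGroupSchemes, §(3.8) p. 145] -/
def evalTwo : WithConv (Module.Dual R B) ⊗[R] WithConv (Module.Dual R B) →ₗ[R] Module.Dual R (B ⊗[R] B) :=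
  TensorProduct.dualDistrib R B B ∘ₗ
    TensorProduct.map (WithConv.linearEquiv R (Module.Dual R B)).toLinearMap
      (WithConv.linearEquiv R (Module.Dual R B)).toLinearMap

variable {R B} in
/-- `evalTwo (g ⊗ h) (x ⊗ y) = g x * h y`. [cite: Tate1997FiniteFlatGroupSchemes, §(3.8) p. 145] -/
@[simp] theorem evalTwo_tmul (g h : WithConv (Module.Dual R B)) (x y : B) :
    evalTwo R B (g ⊗ₜ h) (x ⊗ₜ y) = g x * h y := by
  simp [evalTwo]

/-- **`B^* ⊗ B^* ≃ (B ⊗ B)^*`** for finite free `B`: the evaluation pairing as a linear equivalence.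
[cite: Tate1997FiniteFlatGroupSchemes, §(3.8) p. 145] -/
def evalTwoEquiv [Module.Free R B] [Module.Finite R B] :
    WithConv (Module.Dual R B) ⊗[R] WithConv (Module.Dual R B) ≃ₗ[R] Module.Dual R (B ⊗[R] B) :=
  LinearEquiv.ofBijective (evalTwo R B) (evalTwo_bijective (ev := evalTwo R B) evalTwo_tmul)

variable {R B} in
/-- `evalTwoEquiv` is `evalTwo`. [cite: Tate1997FiniteFlatGroupSchemes, §(3.8) p. 145] -/
@[simp] theorem evalTwoEquiv_apply [Module.Free R B] [Module.Finite R B]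
    (t : WithConv (Module.Dual R B) ⊗[R] WithConv (Module.Dual R B)) : evalTwoEquiv R B t = evalTwo R B t :=
  rfl

/-- **the dual counit `η^* : B^* → R`, `f ↦ f 1`** (`B` with a `1`). [cite: Tate1997FiniteFlatGroupSchemes, §(3.8) p. 145] -/
def counit [One B] : WithConv (Module.Dual R B) →ₗ[R] R :=
  LinearMap.applyₗ (1 : B) ∘ₗ (WithConv.linearEquiv R (Module.Dual R B)).toLinearMap

variable {R B} in
/-- `counit f = f 1`. [cite: Tate1997FiniteFlatGroupSchemes, §(3.8) p. 145] -/
@[simp] theorem counit_apply [One B] (f : WithConv (Module.Dual R B)) : counit R B f = f 1 :=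
  rfl

end Maps

section Comul

variable (R : Type u) [CommSemiring R] (B : Type v) [Semiring B] [Algebra R B] [Module.Free R B] [Module.Finite R B]

/-- **the dual comultiplication `μ^* : B^* → B^* ⊗ B^*`** of a finite free algebra: the transpose of the multiplication
read through `B^* ⊗ B^* ≃ (B ⊗ B)^*`. [cite: Tate1997FiniteFlatGroupSchemes, §(3.8) p. 145] -/
def comul : WithConv (Module.Dual R B) →ₗ[R] WithConv (Module.Dual R B) ⊗[R] WithConv (Module.Dual R B) :=
  (evalTwoEquiv R B).symm.toLinearMap ∘ₗ (LinearMap.mul' R B).dualMap ∘ₗ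
    (WithConv.linearEquiv R (Module.Dual R B)).toLinearMap

variable {R B} in
/-- `evalTwo (comul f) (x ⊗ y) = f (x y)` — the defining equation `hδ` of CD1-thm.
[cite: Tate1997FiniteFlatGroupSchemes, §(3.8) p. 145] -/
@[simp] theorem evalTwo_comul (f : WithConv (Module.Dual R B)) (x y : B) :
    evalTwo R B (comul R B f) (x ⊗ₜ y) = f (x * y) := by
  have h : evalTwo R B ((evalTwoEquiv R B).symm ((LinearMap.mul' R B).dualMap (ofConv f))) =
      (LinearMap.mul' R B).dualMap (ofConv f) :=
    LinearEquiv.apply_ofBijective_symm_apply (evalTwo R B) (h := evalTwo_bijective (ev := evalTwo R B) evalTwo_tmul) _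
  change evalTwo R B ((evalTwoEquiv R B).symm ((LinearMap.mul' R B).dualMap (ofConv f))) (x ⊗ₜ y) = f (x * y)
  rw [h, LinearMap.dualMap_apply, LinearMap.mul'_apply]

variable {R B} in
/-- `evalTwo (comul f) = f ∘ μ` (`= (Tannakian.dualDiag R B f).ofConv` in the tree's vocabulary).
[cite: Tate1997FiniteFlatGroupSchemes, §(3.8) p. 145] -/
theorem evalTwo_comul_eq (f : WithConv (Module.Dual R B)) :
    evalTwo R B (comul R B f) = (ofConv f) ∘ₗ LinearMap.mul' R B :=
  evalTwo_dualComul (ev := evalTwo R B) evalTwo_comul f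

end Comul


/-! ## §2 The bundled structures (reducible definitions — install with `letI`) -/

section Structures

variable (R : Type u) [CommSemiring R] (B : Type v)

/-- **the dual COALGEBRA `B^*` of a finite free algebra** on the carrier `WithConv (Module.Dual R B)`: `Δ = μ^*`, `ε = η^*`
(fields `coassoc`, `rTensor_counit_comp_comul`, `lTensor_counit_comp_comul` = CD1-thm's `dualComul_coassoc`,
`rTensor_dualCounit_comp_dualComul`, `lTensor_dualCounit_comp_dualComul`).  A `def`, not an instance.
[cite: Tate1997FiniteFlatGroupSchemes, §(3.8) p. 145] -/
@[reducible] def coalgebra [Semiring B] [Algebra R B] [Module.Free R B] [Module.Finite R B] :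
    Coalgebra R (WithConv (Module.Dual R B)) where
  comul := comul R B
  counit := counit R B
  coassoc := dualComul_coassoc (ev := evalTwo R B) evalTwo_tmul evalTwo_comul
  rTensor_counit_comp_comul := rTensor_dualCounit_comp_dualComul (ev := evalTwo R B) evalTwo_tmul evalTwo_comul counit_apply
  lTensor_counit_comp_comul := lTensor_dualCounit_comp_dualComul (ev := evalTwo R B) evalTwo_tmul evalTwo_comul counit_apply

/-- **the dual BIALGEBRA `B^*` of a finite free bialgebra**: Mathlib's convolution algebra `LinearMap.convAlgebra` together
with the dual coalgebra (fields `counit_one`, `mul_compr₂_counit`, `comul_one`, `mul_compr₂_comul` = CD1-thm's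
`dualCounit_one`, `mul_compr₂_dualCounit`, `dualComul_one`, `mul_compr₂_dualComul`).  A `def`, not an instance.
[cite: Tate1997FiniteFlatGroupSchemes, §(3.8) p. 145] -/
@[reducible] def bialgebra [Semiring B] [Bialgebra R B] [Module.Free R B] [Module.Finite R B] :
    Bialgebra R (WithConv (Module.Dual R B)) where
  __ := (LinearMap.convAlgebra : Algebra R (WithConv (Module.Dual R B)))
  __ := coalgebra R B
  counit_one := dualCounit_one (ε := counit R B) counit_apply
  mul_compr₂_counit := mul_compr₂_dualCounit (ε := counit R B) counit_apply
  comul_one := dualComul_one (ev := evalTwo R B) evalTwo_tmul evalTwo_comul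
  mul_compr₂_comul := mul_compr₂_dualComul (ev := evalTwo R B) evalTwo_tmul evalTwo_comul

/-- **the dual HOPF ALGEBRA `B^*` of a finite free Hopf algebra**: the dual bialgebra with antipode `S^*` (fields
`mul_antipode_rTensor_comul`, `mul_antipode_lTensor_comul` = CD1-thm's `mul_dualAntipode_rTensor_dualComul`,
`mul_dualAntipode_lTensor_dualComul`).  A `def`, not an instance.  [cite: Tate1997FiniteFlatGroupSchemes, §(3.8) p. 145] -/
@[reducible] def hopfAlgebra [Semiring B] [HopfAlgebra R B] [Module.Free R B] [Module.Finite R B] :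
    HopfAlgebra R (WithConv (Module.Dual R B)) where
  __ := bialgebra R B
  antipode := Literature.AlgebraicGeometry.Motives.Tannakian.dualAntipode
  mul_antipode_rTensor_comul :=
    mul_dualAntipode_rTensor_dualComul (ev := evalTwo R B) evalTwo_tmul evalTwo_comul counit_apply
      Literature.AlgebraicGeometry.Motives.Tannakian.dualAntipode_apply_apply
  mul_antipode_lTensor_comul :=
    mul_dualAntipode_lTensor_dualComul (ev := evalTwo R B) evalTwo_tmul evalTwo_comul counit_apply
      Literature.AlgebraicGeometry.Motives.Tannakian.dualAntipode_apply_apply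

/-- **the dual of a COMMUTATIVE finite free algebra is COCOMMUTATIVE** (`IsCocomm` for the dual coalgebra).
[cite: Tate1997FiniteFlatGroupSchemes, §(3.8) p. 145] -/
theorem isCocomm [CommSemiring B] [Algebra R B] [Module.Free R B] [Module.Finite R B] :
    @Coalgebra.IsCocomm R (WithConv (Module.Dual R B)) _ _ _ (coalgebra R B) := by
  letI := coalgebra R B
  exact ⟨comm_comp_dualComul (ev := evalTwo R B) evalTwo_tmul evalTwo_comul⟩

end Structures

/-! ## §3 Bridge lemmas: the class projections of the bundled structures are the maps of §1 -/

section Bridge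

variable (R : Type u) [CommSemiring R] (B : Type v)

/-- under `coalgebra R B`, `Coalgebra.comul = comul R B`. [cite: Tate1997FiniteFlatGroupSchemes, §(3.8) p. 145] -/
theorem comul_def [Semiring B] [Algebra R B] [Module.Free R B] [Module.Finite R B] :
    (coalgebra R B).comul = comul R B :=
  rfl

/-- under `coalgebra R B`, `Coalgebra.counit = counit R B`. [cite: Tate1997FiniteFlatGroupSchemes, §(3.8) p. 145] -/
theorem counit_def [Semiring B] [Algebra R B] [Module.Free R B] [Module.Finite R B] :
    (coalgebra R B).counit = counit R B :=
  rfl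

/-- under `hopfAlgebra R B`, the antipode is the tree's `Tannakian.dualAntipode` (`f ↦ f ∘ S`).
[cite: Montgomery1993Hopf, 9.1.3] -/
theorem antipode_def [Semiring B] [HopfAlgebra R B] [Module.Free R B] [Module.Finite R B] :
    (hopfAlgebra R B).antipode = Literature.AlgebraicGeometry.Motives.Tannakian.dualAntipode :=
  rfl

/-- the algebra structure of `bialgebra R B` is Mathlib's convolution algebra. [cite: Montgomery1993Hopf, 9.1.3] -/
theorem bialgebra_toAlgebra [Semiring B] [Bialgebra R B] [Module.Free R B] [Module.Finite R B] :
    (bialgebra R B).toAlgebra = LinearMap.convAlgebra :=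
  rfl

end Bridge

section Tannakian

open Literature.AlgebraicGeometry.Motives

variable {R : Type u} [CommRing R] {B : Type v} [CommRing B] [Bialgebra R B]

/-- dictionary: on pure tensors `evalTwo` is the tree's external product `Tannakian.tensorDual` (Milne's pairing `(μ₁, μ₂)`).
[cite: Montgomery1993Hopf, 9.1.3] -/
theorem evalTwo_tmul_eq_tensorDual (g h : WithConv (Module.Dual R B)) :
    evalTwo R B (g ⊗ₜ h) = Tannakian.tensorDual (ofConv g) (ofConv h) :=
  TensorProduct.ext' fun x y => by rw [evalTwo_tmul, Tannakian.tensorDual_tmul]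

/-- dictionary: `evalTwo ∘ comul` is the tree's `Tannakian.dualDiag : B^* →ₐ[R] (B ⊗ B)^*` (`μ ↦ μ ∘ m`) — the dual
comultiplication of this file is `dualDiag` read through `B^* ⊗ B^* ≃ (B ⊗ B)^*`. [cite: Montgomery1993Hopf, 9.1.3] -/
theorem evalTwo_comul_eq_dualDiag [Module.Free R B] [Module.Finite R B] (f : WithConv (Module.Dual R B)) :
    evalTwo R B (comul R B f) = (Tannakian.dualDiag R B f).ofConv := by
  rw [evalTwo_comul_eq, Tannakian.dualDiag_apply_ofConv]

variable (R B) in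
/-- dictionary: the dual counit is the tree's algebra map `Tannakian.dualCounit : B^* →ₐ[R] R` (`μ ↦ μ 1`) as a linear map.
[cite: Montgomery1993Hopf, 9.1.3] -/
theorem counit_eq_dualCounit : counit R B = (Tannakian.dualCounit R B).toLinearMap :=
  LinearMap.ext fun f => by rw [counit_apply, AlgHom.toLinearMap_apply, Tannakian.dualCounit_apply]

end Tannakian

end FiniteDual

end Literature.RingTheory.HopfAlgebra

end
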